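import Summits.CriticalPhenomena.PercolationContinuityZ3.Theorems.PercNearOneGluingNoHeavyLowerTailWorstPairExchangeCex

/-!
# `NoHeavyLowerTail` (crux stmt-CriticalPhenomena-4575): the (ML-na) counterexample — CHECKER AND ARITHMETIC

Computational half of the refutation of the non-adjacent champion-shift condition (ML-na) (the hypothesis
`hML` of `setCS_of_MLna` / `noHeavyLowerTail_of_MLna`, file
`PercNearOneGluingNoHeavyLowerTailCILInductionNonAdjacent.lean`); the measure-theoretic half and the
deliverables `not_MLna_six`, `not_MLna` are in `PercNearOneGluingNoHeavyLowerTailMLnaCex.lean`.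

Witness (ttrl engine census `run/shared/lean/ttrl/mlna/README.md`, series-reduced, n = 6): relays `A = {0,1,2}`,
glued set `S = {3,4}`, Steiner vertex `5`, level `j = 1`, champion `c = 2`; weights `w(0,1) = 3/5`,
`w(0,3) = 1/5`, `w(0,4) = 3/10`, `w(0,5) = 2/5`, `w(1,2) = 1/2`, `w(1,3) = 4/5`, `w(1,5) = 3/5`, `w(2,5) = 4/5`,
`w(4,5) = 9/10` (list `wit`); positive pairs at `S`: `E_S = {03, 13, 04, 45}`.

Contents (the generic evaluation lemma `WorstPairExchangeCex.real_eq_wcount` — probability of an event whose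
per-configuration indicator is a `Bool` test on the reach tables = exact weighted count — is imported): switching a set `F` of pairs off inside a weighted edge list
(`zeroOut`, `wOfList_zeroOut`) and its value on the witness (`zeroOut_wit` = `witB` at four membership bits);
the three events of (ML-na) — lightness `|π(x)| ≤ 1`, "far from `S` and light", "meets `S` and the glued `S` is
light" — as `Bool` tests (`lightB`, `jfarB`, `jnearB`) and exact counts (`cntI`, `cntJfar`, `cntJnear`); and the
ARITHMETIC, all by KERNEL reduction (`decide +kernel`, standard axioms, no `native_decide`):
`facts_wit` (`I(0) ≤ I(2)`, `I(1) ≤ I(2)`: `2` is a champion; `I(2) < I(3)`, `I(2) < I(4)`: `S` is light;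
`J(2) < J(0)`), `facts_witB` (for each of the 15 nonempty `F ⊆ E_S`: `I_F(1) < I_F(0)` and `I_F(2) < I_F(0)`, so
the relay `0` is the unique champion of `w^F`), `pairs_at_three/four` (the positive pairs at `S`).
Exact values: `I(0) = 126777/781250`, `I(1) = 118797/1562500`, `I(2) = 1063/6250`, `I(3) = 176293/781250`,
`I(4) = 29491/156250`, `J(0) = 55143/390625`, `J(2) = 18637/156250`.  No sorries; the `def`s are computable
checkers and witness data only.
-/

namespace Summit.CriticalPhenomena.PercolationContinuityZ3.Theorems

open MeasureTheory
open Literature.Probability.LatticeModels Literature.Probability.Percolation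
open Summit.CriticalPhenomena.PercolationContinuityZ3.Theorems.AdditiveGluing.Negative.Cert

namespace MLnaCex

/-! ### Switching a set of pairs off inside a weighted edge list -/

/-- The weighted edge list with the weights of the pairs in `F` replaced by `0`. -/
def zeroOut {n : ℕ} (F : Finset (Sym2 (Fin n))) (l : List (Fin n × Fin n × ℚ)) :
    List (Fin n × Fin n × ℚ) :=
  l.map fun t => (t.1, t.2.1, if mkE (t.1, t.2.1) ∈ F then 0 else t.2.2)

/-- `zeroOut` does not change the listed pairs. [this file] -/
theorem wPairs_zeroOut {n : ℕ} (F : Finset (Sym2 (Fin n))) (l : List (Fin n × Fin n × ℚ)) :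
    wPairs (zeroOut F l) = wPairs l := by
  simp [wPairs, zeroOut]

/-- `zeroOut` keeps the weights in `[0, 1]`. [this file] -/
theorem zeroOut_weights {n : ℕ} (F : Finset (Sym2 (Fin n))) (l : List (Fin n × Fin n × ℚ))
    (hq : ∀ e ∈ l, 0 ≤ e.2.2 ∧ e.2.2 ≤ 1) : ∀ e ∈ zeroOut F l, 0 ≤ e.2.2 ∧ e.2.2 ≤ 1 := by
  intro e he
  simp only [zeroOut, List.mem_map] at he
  obtain ⟨t, ht, rfl⟩ := he
  dsimp only
  split_ifs
  · exact ⟨le_rfl, zero_le_one⟩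
  · exact hq t ht

/-- **Switching `F` off is `zeroOut`.**  The weight function of `zeroOut F l` is the weight function of `l`
with the pairs in `F` set to `0`. [this file] -/
theorem wOfList_zeroOut {n : ℕ} (F : Finset (Sym2 (Fin n))) :
    ∀ (l : List (Fin n × Fin n × ℚ)) (x : Sym2 (Fin n)),
      wOfList (zeroOut F l) x = if x ∈ F then 0 else wOfList l x
  | [], x => by simp [zeroOut, wOfList]
  | e :: l, x => by
    have ih := wOfList_zeroOut F l x
    simp only [zeroOut, List.map_cons] at ih ⊢
    simp only [wOfList]
    by_cases hx : x = mkE (e.1, e.2.1)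
    · rw [if_pos hx, if_pos hx]
      by_cases hF : x ∈ F
      · rw [if_pos (hx ▸ hF), if_pos hF]
        ext
        simp [Set.projIcc]
      · rw [if_neg (hx ▸ hF), if_neg hF]
    · rw [if_neg hx, if_neg hx]
      exact ih

/-! ### The witness -/

/-- The witness weights: `w(0,1) = 3/5, w(0,3) = 1/5, w(0,4) = 3/10, w(0,5) = 2/5, w(1,2) = 1/2, w(1,3) = 4/5,
w(1,5) = 3/5, w(2,5) = 4/5, w(4,5) = 9/10`. -/
def wit : List (Fin 6 × Fin 6 × ℚ) :=
  [(0, 1, 3/5), (0, 3, 1/5), (0, 4, 3/10), (0, 5, 2/5), (1, 2, 1/2), (1, 3, 4/5), (1, 5, 3/5), (2, 5, 4/5),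
    (4, 5, 9/10)]

/-- The witness with the `S`-pairs `03, 13, 04, 45` switched off according to four bits. -/
def witB (b03 b13 b04 b45 : Bool) : List (Fin 6 × Fin 6 × ℚ) :=
  [(0, 1, 3/5), (0, 3, if b03 = true then 0 else 1/5), (0, 4, if b04 = true then 0 else 3/10), (0, 5, 2/5),
    (1, 2, 1/2), (1, 3, if b13 = true then 0 else 4/5), (1, 5, 3/5), (2, 5, 4/5),
    (4, 5, if b45 = true then 0 else 9/10)]

/-- The listed pairs of the witness are distinct. [this file] -/
theorem wit_nodup : (wPairs wit).Nodup := by decide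

/-- The witness weights lie in `[0, 1]`. [this file] -/
theorem wit_weights : ∀ e ∈ wit, 0 ≤ e.2.2 ∧ e.2.2 ≤ 1 := by
  intro e he
  simp only [wit, List.mem_cons, List.not_mem_nil, or_false] at he
  rcases he with rfl | rfl | rfl | rfl | rfl | rfl | rfl | rfl | rfl <;> norm_num

/-- The listed pairs of `witB` are those of `wit`. [this file] -/
theorem wPairs_witB (b03 b13 b04 b45 : Bool) : wPairs (witB b03 b13 b04 b45) = wPairs wit := rfl

/-- The listed pairs of `witB` are distinct. [this file] -/
theorem witB_nodup (b03 b13 b04 b45 : Bool) : (wPairs (witB b03 b13 b04 b45)).Nodup := by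
  rw [wPairs_witB]; exact wit_nodup

/-- The `witB` weights lie in `[0, 1]`. [this file] -/
theorem witB_weights (b03 b13 b04 b45 : Bool) : ∀ e ∈ witB b03 b13 b04 b45, 0 ≤ e.2.2 ∧ e.2.2 ≤ 1 := by
  intro e he
  simp only [witB, List.mem_cons, List.not_mem_nil, or_false] at he
  rcases he with rfl | rfl | rfl | rfl | rfl | rfl | rfl | rfl | rfl <;> dsimp only <;>
    (try split_ifs) <;> norm_num

/-- Switching off a set `F` of pairs that avoids the five non-`S` pairs of the witness is `witB` at the four
membership bits of the `S`-pairs. [this file] -/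
theorem zeroOut_wit (F : Finset (Sym2 (Fin 6))) (h01 : s(0, 1) ∉ F) (h05 : s(0, 5) ∉ F) (h12 : s(1, 2) ∉ F)
    (h15 : s(1, 5) ∉ F) (h25 : s(2, 5) ∉ F) :
    zeroOut F wit = witB (decide (s(0, 3) ∈ F)) (decide (s(1, 3) ∈ F)) (decide (s(0, 4) ∈ F))
      (decide (s(4, 5) ∈ F)) := by
  simp [zeroOut, wit, witB, mkE, h01, h05, h12, h15, h25]

/-! ### The three events of (ML-na) as `Bool` tests on reach tables -/

/-- Number of relays `{0,1,2}` reachable from `x` according to a reach table. -/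
def nrel (tb : List ℕ) (x : Fin 6) : ℕ :=
  (({0, 1, 2} : Finset (Fin 6)).filter fun z : Fin 6 => (tb.getD x.val 0).testBit z.val = true).card

/-- `x` is light (`|π(x)| ≤ 1`). -/
def lightB (tb : List ℕ) (x : Fin 6) : Bool := decide (nrel tb x ≤ 1)

/-- `x` is far from `S = {3,4}` and light. -/
def jfarB (tb : List ℕ) (x : Fin 6) : Bool :=
  decide ((∀ y ∈ ({3, 4} : Finset (Fin 6)), (tb.getD x.val 0).testBit y.val = false) ∧ nrel tb x ≤ 1)

/-- `x` meets `S = {3,4}` and the glued vertex `S` is light. -/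
def jnearB (tb : List ℕ) (x : Fin 6) : Bool :=
  decide ((∃ y ∈ ({3, 4} : Finset (Fin 6)), (tb.getD x.val 0).testBit y.val = true) ∧
    (({0, 1, 2} : Finset (Fin 6)).filter fun z : Fin 6 =>
      ∃ y ∈ ({3, 4} : Finset (Fin 6)), (tb.getD y.val 0).testBit z.val = true).card ≤ 1)

/-- Exact lightness count `I(x)` of a weighted edge list on `Fin 6`. -/
def cntI (l : List (Fin 6 × Fin 6 × ℚ)) (x : Fin 6) : ℚ :=
  ((wtabs 6 l).map fun t => if lightB t.1 x then t.2 else 0).sum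

/-- Exact count of "far from `S` and light". -/
def cntJfar (l : List (Fin 6 × Fin 6 × ℚ)) (x : Fin 6) : ℚ :=
  ((wtabs 6 l).map fun t => if jfarB t.1 x then t.2 else 0).sum

/-- Exact count of "meets `S` and the glued `S` is light". -/
def cntJnear (l : List (Fin 6 × Fin 6 × ℚ)) (x : Fin 6) : ℚ :=
  ((wtabs 6 l).map fun t => if jnearB t.1 x then t.2 else 0).sum

/-! ### The arithmetic (exact rational counts over `2⁹` configurations) -/

/-- The facts about the witness itself: `2` is a champion (`I(0) ≤ I(2)`, `I(1) ≤ I(2)`), `S = {3,4}` is light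
(`I(2) < I(3)`, `I(2) < I(4)`), and `J(2) < J(0)`. [this file] -/
theorem facts_wit : cntI wit 0 ≤ cntI wit 2 ∧ cntI wit 1 ≤ cntI wit 2 ∧ cntI wit 2 < cntI wit 3 ∧
    cntI wit 2 < cntI wit 4 ∧ cntJfar wit 2 + cntJnear wit 2 < cntJfar wit 0 + cntJnear wit 0 := by
  decide +kernel

/-- Case `ffft` of `facts_witB` (bits for the pairs `03, 13, 04, 45`). [this file] -/
theorem facts_witB_ffft : cntI (witB false false false true) 1 < cntI (witB false false false true) 0 ∧
    cntI (witB false false false true) 2 < cntI (witB false false false true) 0 := by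
  decide +kernel

/-- Case `fftf` of `facts_witB` (bits for the pairs `03, 13, 04, 45`). [this file] -/
theorem facts_witB_fftf : cntI (witB false false true false) 1 < cntI (witB false false true false) 0 ∧
    cntI (witB false false true false) 2 < cntI (witB false false true false) 0 := by
  decide +kernel

/-- Case `fftt` of `facts_witB` (bits for the pairs `03, 13, 04, 45`). [this file] -/
theorem facts_witB_fftt : cntI (witB false false true true) 1 < cntI (witB false false true true) 0 ∧
    cntI (witB false false true true) 2 < cntI (witB false false true true) 0 := by
  decide +kernel

/-- Case `ftff` of `facts_witB` (bits for the pairs `03, 13, 04, 45`). [this file] -/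
theorem facts_witB_ftff : cntI (witB false true false false) 1 < cntI (witB false true false false) 0 ∧
    cntI (witB false true false false) 2 < cntI (witB false true false false) 0 := by
  decide +kernel

/-- Case `ftft` of `facts_witB` (bits for the pairs `03, 13, 04, 45`). [this file] -/
theorem facts_witB_ftft : cntI (witB false true false true) 1 < cntI (witB false true false true) 0 ∧
    cntI (witB false true false true) 2 < cntI (witB false true false true) 0 := by
  decide +kernel

/-- Case `fttf` of `facts_witB` (bits for the pairs `03, 13, 04, 45`). [this file] -/
theorem facts_witB_fttf : cntI (witB false true true false) 1 < cntI (witB false true true false) 0 ∧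
    cntI (witB false true true false) 2 < cntI (witB false true true false) 0 := by
  decide +kernel

/-- Case `fttt` of `facts_witB` (bits for the pairs `03, 13, 04, 45`). [this file] -/
theorem facts_witB_fttt : cntI (witB false true true true) 1 < cntI (witB false true true true) 0 ∧
    cntI (witB false true true true) 2 < cntI (witB false true true true) 0 := by
  decide +kernel

/-- Case `tfff` of `facts_witB` (bits for the pairs `03, 13, 04, 45`). [this file] -/
theorem facts_witB_tfff : cntI (witB true false false false) 1 < cntI (witB true false false false) 0 ∧
    cntI (witB true false false false) 2 < cntI (witB true false false false) 0 := by
  decide +kernel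

/-- Case `tfft` of `facts_witB` (bits for the pairs `03, 13, 04, 45`). [this file] -/
theorem facts_witB_tfft : cntI (witB true false false true) 1 < cntI (witB true false false true) 0 ∧
    cntI (witB true false false true) 2 < cntI (witB true false false true) 0 := by
  decide +kernel

/-- Case `tftf` of `facts_witB` (bits for the pairs `03, 13, 04, 45`). [this file] -/
theorem facts_witB_tftf : cntI (witB true false true false) 1 < cntI (witB true false true false) 0 ∧
    cntI (witB true false true false) 2 < cntI (witB true false true false) 0 := by
  decide +kernel

/-- Case `tftt` of `facts_witB` (bits for the pairs `03, 13, 04, 45`). [this file] -/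
theorem facts_witB_tftt : cntI (witB true false true true) 1 < cntI (witB true false true true) 0 ∧
    cntI (witB true false true true) 2 < cntI (witB true false true true) 0 := by
  decide +kernel

/-- Case `ttff` of `facts_witB` (bits for the pairs `03, 13, 04, 45`). [this file] -/
theorem facts_witB_ttff : cntI (witB true true false false) 1 < cntI (witB true true false false) 0 ∧
    cntI (witB true true false false) 2 < cntI (witB true true false false) 0 := by
  decide +kernel

/-- Case `ttft` of `facts_witB` (bits for the pairs `03, 13, 04, 45`). [this file] -/
theorem facts_witB_ttft : cntI (witB true true false true) 1 < cntI (witB true true false true) 0 ∧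
    cntI (witB true true false true) 2 < cntI (witB true true false true) 0 := by
  decide +kernel

/-- Case `tttf` of `facts_witB` (bits for the pairs `03, 13, 04, 45`). [this file] -/
theorem facts_witB_tttf : cntI (witB true true true false) 1 < cntI (witB true true true false) 0 ∧
    cntI (witB true true true false) 2 < cntI (witB true true true false) 0 := by
  decide +kernel

/-- Case `tttt` of `facts_witB` (bits for the pairs `03, 13, 04, 45`). [this file] -/
theorem facts_witB_tttt : cntI (witB true true true true) 1 < cntI (witB true true true true) 0 ∧
    cntI (witB true true true true) 2 < cntI (witB true true true true) 0 := by
  decide +kernel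

/-- For every nonempty `F ⊆ E_S` the relay `0` is strictly LONELIER (larger lightness `I`) than `1` and `2`
in `w^F` (15 cases, each two exact counts over `2⁹` configurations, checked by kernel reduction). [this file] -/
theorem facts_witB : ∀ b03 b13 b04 b45 : Bool, (b03 || b13 || b04 || b45) = true →
    cntI (witB b03 b13 b04 b45) 1 < cntI (witB b03 b13 b04 b45) 0 ∧
      cntI (witB b03 b13 b04 b45) 2 < cntI (witB b03 b13 b04 b45) 0 := by
  intro b03 b13 b04 b45 h
  cases b03 <;> cases b13 <;> cases b04 <;> cases b45
  · exact absurd h (by decide)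
  · exact facts_witB_ffft
  · exact facts_witB_fftf
  · exact facts_witB_fftt
  · exact facts_witB_ftff
  · exact facts_witB_ftft
  · exact facts_witB_fttf
  · exact facts_witB_fttt
  · exact facts_witB_tfff
  · exact facts_witB_tfft
  · exact facts_witB_tftf
  · exact facts_witB_tftt
  · exact facts_witB_ttff
  · exact facts_witB_ttft
  · exact facts_witB_tttf
  · exact facts_witB_tttt

/-- The positive pairs of the witness at `S = {3,4}` are `03, 13, 04, 45` (as seen from `3`). [this file] -/
theorem pairs_at_three : ∀ y : Fin 6, y ≠ 3 → s(3, y) ∈ wE wit →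
    s(3, y) = s(0, 3) ∨ s(3, y) = s(1, 3) ∨ s(3, y) = s(0, 4) ∨ s(3, y) = s(4, 5) := by
  decide

/-- The positive pairs of the witness at `S = {3,4}` are `03, 13, 04, 45` (as seen from `4`). [this file] -/
theorem pairs_at_four : ∀ y : Fin 6, y ≠ 4 → s(4, y) ∈ wE wit →
    s(4, y) = s(0, 3) ∨ s(4, y) = s(1, 3) ∨ s(4, y) = s(0, 4) ∨ s(4, y) = s(4, 5) := by
  decide

end MLnaCex

end Summit.CriticalPhenomena.PercolationContinuityZ3.Theorems
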